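import Mathlib
import Summits.Ventures.PercRepro2.Defs
import Summits.Ventures.PercRepro2.Independence
import Summits.Ventures.PercRepro2.Harris
import Summits.Ventures.PercRepro2.Graph
import Summits.Ventures.PercRepro2.Exploration
import Summits.Ventures.PercRepro2.Events
import Summits.Ventures.PercRepro2.Induced
import Summits.Ventures.PercRepro2.BHK
import Summits.Ventures.PercRepro2.BHKEvents
import Summits.Ventures.PercRepro2.OneEdge
import Summits.Ventures.PercRepro2.RBRoot
import Summits.Ventures.PercRepro2.RBRootEdge
import Summits.Ventures.PercRepro2.RBRootEdgePin
import Summits.Ventures.PercRepro2.RBRootEdgeMain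
import Summits.Ventures.PercRepro2.RBRootIsolated
import Summits.Ventures.PercRepro2.RBTwoMarkers
import Summits.Ventures.PercRepro2.RBTwoMarkersMain
import Summits.Ventures.PercRepro2.RBTwoMarkersCross
import Summits.Ventures.PercRepro2.RBTwoMarkersCrossMain
import Summits.Ventures.PercRepro2.RBLeaf
import Summits.Ventures.PercRepro2.RBSeries
import Summits.Ventures.PercRepro2.RBSeriesMain
import Summits.Ventures.PercRepro2.RBSeriesMass
import Summits.Ventures.PercRepro2.RBDefs
import Summits.Ventures.PercRepro2.RBRootDefs

/-!
# The series reduction, IV: the Rao–Blackwell sum is preserved (mine-a g5; MINE-A.md §36)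

`rbSum_series`: for an unmarked vertex `u ∉ {s, t, w}` whose only edges of nonzero weight are
`f₁ = {u, v₁}`, `f₂ = {u, v₂}`, and an edge `e₀ = {v₁, v₂}` of the graph (any weight, `v₁ ≠ v₂`
not required), the Rao–Blackwell sum at `w` for connection events among vertices `≠ u` is that of
`p* = p[e₀ ↦ p e₀ + (1 − p e₀) p f₁ p f₂][f₁ ↦ 0][f₂ ↦ 0]`. Per `G*`-atom `A′ ∌ u` the two
`G`-atoms `A′`, `A′ ∪ {u}` recombine (`pair_term`): a constant split when exactly one of `v₁, v₂`
lies in `A′` (the forced-open boundary atom is null), the domain Markov step (`ratio_split`) when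
both do.
-/

namespace Summit.Ventures.PercRepro2
namespace RBSeries

open scoped Classical

section Algebra

variable {R : Type*} [Field R] [LinearOrder R] [IsStrictOrderedRing R]

/-- **The pair identity** (pure algebra): the two `G`-terms above a `G*`-atom add up to the
`G*`-term. `c₁, c₂` say whether `v₁, v₂` lie in the atom; `t₁, t₀` are the masses of an event
under the effective laws with `e₀` open / closed, `t̄ = q t₁ + (1 − q) t₀`. -/
lemma pair_term {p₁ p₂ q x₁ x₀ y₁ y₀ z₁ z₀ : R} (hp₁ : 0 ≤ p₁) (hp₁' : p₁ ≤ 1) (hp₂ : 0 ≤ p₂)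
    (hp₂' : p₂ ≤ 1) (hq : 0 ≤ q) (hq' : q ≤ 1) (hz₁ : 0 ≤ z₁) (hz₀ : 0 ≤ z₀)
    (hx₁ : z₁ = 0 → x₁ = 0 ∧ y₁ = 0) (hx₀ : z₀ = 0 → x₀ = 0 ∧ y₀ = 0) (c₁ c₂ : Prop)
    [Decidable c₁] [Decidable c₂]
    (hmark : c₁ ∧ c₂ → x₁ * z₀ = x₀ * z₁ ∧ y₁ * z₀ = y₀ * z₁)
    (hbd : (c₁ ∧ ¬ c₂) ∨ (¬ c₁ ∧ c₂) → x₁ = 0 ∧ y₁ = 0 ∧ z₁ = 0) :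
    let m : R → R → R := fun t₁ t₀ =>
      p₁ * p₂ * (if ¬ (c₁ ∨ c₂) then t₁ else 0) +
        p₁ * (1 - p₂) * (if ¬ c₁ then q * t₁ + (1 - q) * t₀ else 0) +
        (1 - p₁) * p₂ * (if ¬ c₂ then q * t₁ + (1 - q) * t₀ else 0) +
        (1 - p₁) * (1 - p₂) * (q * t₁ + (1 - q) * t₀)
    let m' : R → R → R := fun t₁ t₀ =>
      p₁ * p₂ * (if c₁ ∨ c₂ then t₁ else 0) +
        p₁ * (1 - p₂) * (if c₁ then q * t₁ + (1 - q) * t₀ else 0) +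
        (1 - p₁) * p₂ * (if c₂ then q * t₁ + (1 - q) * t₀ else 0)
    m x₁ x₀ * m y₁ y₀ / m z₁ z₀ + m' x₁ x₀ * m' y₁ y₀ / m' z₁ z₀ =
      ((q + (1 - q) * (p₁ * p₂)) * x₁ + (1 - (q + (1 - q) * (p₁ * p₂))) * x₀) *
        ((q + (1 - q) * (p₁ * p₂)) * y₁ + (1 - (q + (1 - q) * (p₁ * p₂))) * y₀) /
        ((q + (1 - q) * (p₁ * p₂)) * z₁ + (1 - (q + (1 - q) * (p₁ * p₂))) * z₀) := by
  intro m m'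
  have hq1 : 0 ≤ 1 - q := sub_nonneg.2 hq'
  have hp₁1 : 0 ≤ 1 - p₁ := sub_nonneg.2 hp₁'
  have hp₂1 : 0 ≤ 1 - p₂ := sub_nonneg.2 hp₂'
  by_cases h₁ : c₁ <;> by_cases h₂ : c₂
  · -- both markers in the atom: the domain Markov step
    obtain ⟨hx, hy⟩ := hmark ⟨h₁, h₂⟩
    simp only [m, m', h₁, h₂, or_true, not_true_eq_false, if_true, if_false, mul_zero,
      zero_add, add_zero]
    have e1 : ∀ t₁ t₀ : R, (1 - p₁) * (1 - p₂) * (q * t₁ + (1 - q) * t₀) =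
        ((1 - p₁) * (1 - p₂) * q) * t₁ + ((1 - p₁) * (1 - p₂) * (1 - q)) * t₀ := fun _ _ => by ring
    have e2 : ∀ t₁ t₀ : R, p₁ * p₂ * t₁ + p₁ * (1 - p₂) * (q * t₁ + (1 - q) * t₀) +
        (1 - p₁) * p₂ * (q * t₁ + (1 - q) * t₀) =
        (p₁ * p₂ + (p₁ * (1 - p₂) + (1 - p₁) * p₂) * q) * t₁ +
          ((p₁ * (1 - p₂) + (1 - p₁) * p₂) * (1 - q)) * t₀ := fun _ _ => by ring
    rw [e1, e1, e1, e2, e2, e2,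
      ratio_split hx hy (mul_nonneg (mul_nonneg hp₁1 hp₂1) hq) (mul_nonneg (mul_nonneg hp₁1 hp₂1) hq1)
        hz₁ hz₀ hx₁ hx₀,
      ratio_split hx hy (add_nonneg (mul_nonneg hp₁ hp₂) (mul_nonneg (add_nonneg (mul_nonneg hp₁ hp₂1)
        (mul_nonneg hp₁1 hp₂)) hq)) (mul_nonneg (add_nonneg (mul_nonneg hp₁ hp₂1) (mul_nonneg hp₁1 hp₂))
        hq1) hz₁ hz₀ hx₁ hx₀,
      ratio_split hx hy (add_nonneg hq (mul_nonneg hq1 (mul_nonneg hp₁ hp₂)))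
        (by nlinarith [mul_nonneg hp₁ hp₂, mul_le_one₀ hp₁' hp₂ hp₂']) hz₁ hz₀ hx₁ hx₀]
    ring
  · -- `v₁` in, `v₂` out: the open-boundary masses vanish, constant split
    obtain ⟨hx1, hy1, hz1⟩ := hbd (Or.inl ⟨h₁, h₂⟩)
    subst hx1; subst hy1; subst hz1
    simp only [m, m', h₁, h₂, true_or, not_true_eq_false, not_false_eq_true, if_true, if_false,
      mul_zero, zero_add, add_zero]
    have e : ∀ t₀ : R, (1 - p₁) * p₂ * ((1 - q) * t₀) + (1 - p₁) * (1 - p₂) * ((1 - q) * t₀) =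
        ((1 - p₁) * (1 - q)) * t₀ := fun _ => by ring
    have e' : ∀ t₀ : R, p₁ * (1 - p₂) * ((1 - q) * t₀) = (p₁ * (1 - p₂) * (1 - q)) * t₀ :=
      fun _ => by ring
    rw [e, e, e, e', e', e', RBLeaf.mul_div_mul_self', RBLeaf.mul_div_mul_self',
      RBLeaf.mul_div_mul_self']
    ring
  · -- `v₂` in, `v₁` out
    obtain ⟨hx1, hy1, hz1⟩ := hbd (Or.inr ⟨h₁, h₂⟩)
    subst hx1; subst hy1; subst hz1
    simp only [m, m', h₁, h₂, or_true, not_true_eq_false, not_false_eq_true, if_true, if_false,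
      mul_zero, zero_add, add_zero]
    have e : ∀ t₀ : R, p₁ * (1 - p₂) * ((1 - q) * t₀) + (1 - p₁) * (1 - p₂) * ((1 - q) * t₀) =
        ((1 - p₂) * (1 - q)) * t₀ := fun _ => by ring
    have e' : ∀ t₀ : R, (1 - p₁) * p₂ * ((1 - q) * t₀) = ((1 - p₁) * p₂ * (1 - q)) * t₀ :=
      fun _ => by ring
    rw [e, e, e, e', e', e', RBLeaf.mul_div_mul_self', RBLeaf.mul_div_mul_self',
      RBLeaf.mul_div_mul_self']
    ring
  · -- neither: the `G`-atom `A′` carries the `G*`-mass, `A′ ∪ {u}` is empty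
    simp only [m, m', h₁, h₂, or_self, not_false_eq_true, if_true, if_false, mul_zero, add_zero,
      div_zero]
    have e : ∀ t₁ t₀ : R, p₁ * p₂ * t₁ + p₁ * (1 - p₂) * (q * t₁ + (1 - q) * t₀) +
        (1 - p₁) * p₂ * (q * t₁ + (1 - q) * t₀) + (1 - p₁) * (1 - p₂) * (q * t₁ + (1 - q) * t₀) =
        (q + (1 - q) * (p₁ * p₂)) * t₁ + (1 - (q + (1 - q) * (p₁ * p₂))) * t₀ := fun _ _ => by ring
    rw [e, e, e]

end Algebra


section Sum

variable {V : Type*} {E : Type*} [Fintype E] [DecidableEq E] [Fintype V] {R : Type*} [Field R]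
  [LinearOrder R] [IsStrictOrderedRing R] (ends : E → Sym2 V) (s t w u : V)

/-- **The series reduction preserves the Rao–Blackwell sum**: `u ∉ {s, t, w}` with exactly the
edges `f₁ = {u, v₁}`, `f₂ = {u, v₂}` of nonzero weight, `e₀ = {v₁, v₂}` an edge; for connection
events among vertices `≠ u`, `rbSum p = rbSum p*` with
`p* = p[e₀ ↦ p e₀ + (1 − p e₀) p f₁ p f₂][f₁ ↦ 0][f₂ ↦ 0]`. -/
theorem rbSum_series (p : E → R) (hp : IsProbVec p) {e₀ f₁ f₂ : E} {v₁ v₂ : V}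
    (hends₀ : ends e₀ = s(v₁, v₂)) (hends₁ : ends f₁ = s(u, v₁)) (hends₂ : ends f₂ = s(u, v₂))
    (hv₁ : v₁ ≠ u) (hv₂ : v₂ ≠ u) (h12 : f₁ ≠ f₂) (h01 : e₀ ≠ f₁) (h02 : e₀ ≠ f₂)
    (hz : ∀ e, u ∈ ends e ∧ e ≠ f₁ ∧ e ≠ f₂ → p e = 0) (hwu : w ≠ u) (hsu : s ≠ u) (htu : t ≠ u)
    {x y x' y' : V} (hx : x ≠ u) (hy : y ≠ u) (hx' : x' ≠ u) (hy' : y' ≠ u) :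
    RBRoot.rbSum p ends s t w (connEvent ends x y) (connEvent ends x' y') =
      RBRoot.rbSum (Function.update (Function.update (Function.update p e₀
        (p e₀ + (1 - p e₀) * (p f₁ * p f₂))) f₁ 0) f₂ 0) ends s t w (connEvent ends x y)
        (connEvent ends x' y') := by
  have hX : ∀ ω : Config E, (∀ e, u ∈ ends e ∧ e ≠ f₁ ∧ e ≠ f₂ → ω e = false) →
      (ω ∈ connEvent ends x y ↔ eff e₀ f₁ f₂ ω ∈ connEvent ends x y) := by
    intro ω hcl
    simp only [mem_connEvent]
    exact conn_series ends u hends₀ hends₁ hends₂ hv₂ h12 h01 h02 hcl hx hy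
  have hY : ∀ ω : Config E, (∀ e, u ∈ ends e ∧ e ≠ f₁ ∧ e ≠ f₂ → ω e = false) →
      (ω ∈ connEvent ends x' y' ↔ eff e₀ f₁ f₂ ω ∈ connEvent ends x' y') := by
    intro ω hcl
    simp only [mem_connEvent]
    exact conn_series ends u hends₀ hends₁ hends₂ hv₂ h12 h01 h02 hcl hx' hy'
  have hU : ∀ ω : Config E, (∀ e, u ∈ ends e ∧ e ≠ f₁ ∧ e ≠ f₂ → ω e = false) →
      (ω ∈ (Set.univ : Set (Config E)) ↔ eff e₀ f₁ f₂ ω ∈ Set.univ) := fun _ _ => Iff.rfl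
  -- the effective laws
  have hp1 : IsProbVec (Function.update (Function.update (Function.update p f₁ 0) f₂ 0) e₀ 1) :=
    ((hp.update f₁ le_rfl zero_le_one).update f₂ le_rfl zero_le_one).update e₀ zero_le_one le_rfl
  have hp0 : IsProbVec (Function.update (Function.update (Function.update p f₁ 0) f₂ 0) e₀ 0) :=
    ((hp.update f₁ le_rfl zero_le_one).update f₂ le_rfl zero_le_one).update e₀ le_rfl zero_le_one
  have hq : p e₀ + (1 - p e₀) * (p f₁ * p f₂) ≤ 1 := by
    nlinarith [hp.nonneg e₀, hp.le_one e₀, mul_nonneg (hp.nonneg f₁) (hp.nonneg f₂),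
      mul_le_one₀ (hp.le_one f₁) (hp.nonneg f₂) (hp.le_one f₂)]
  have hstar : ∀ S : Set (Config E), prob (Function.update (Function.update (Function.update p e₀
      (p e₀ + (1 - p e₀) * (p f₁ * p f₂))) f₁ 0) f₂ 0) S =
      (p e₀ + (1 - p e₀) * (p f₁ * p f₂)) *
          prob (Function.update (Function.update (Function.update p f₁ 0) f₂ 0) e₀ 1) S +
        (1 - (p e₀ + (1 - p e₀) * (p f₁ * p f₂))) *
          prob (Function.update (Function.update (Function.update p f₁ 0) f₂ 0) e₀ 0) S := by
    intro S
    have hcomm : ∀ c : R, Function.update (Function.update (Function.update (Function.update p e₀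
        (p e₀ + (1 - p e₀) * (p f₁ * p f₂))) f₁ 0) f₂ 0) e₀ c =
        Function.update (Function.update (Function.update p f₁ 0) f₂ 0) e₀ c := by
      intro c
      rw [Function.update_comm h02.symm, Function.update_comm h01.symm, Function.update_idem,
        Function.update_comm h01, Function.update_comm h02]
    rw [prob_eq_pin _ S e₀, Function.update_of_ne h02, Function.update_of_ne h01, Function.update_self,
      hcomm, hcomm]
  unfold RBRoot.rbSum
  refine sum_split_pair _ _ u ?_ ?_
  · -- atoms containing `u` are null under `p*`
    intro A hu
    have hz' : ∀ e, u ∈ ends e ∧ e ≠ f₂ → Function.update (Function.update p e₀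
        (p e₀ + (1 - p e₀) * (p f₁ * p f₂))) f₁ 0 e = 0 := by
      rintro e ⟨he, hne⟩
      by_cases h1 : e = f₁
      · subst h1; exact Function.update_self _ _ _
      · rw [Function.update_of_ne h1]
        have h0 : e ≠ e₀ := by
          rintro rfl
          rw [hends₀] at he
          rcases Sym2.mem_iff.1 he with h | h
          · exact hv₁ h.symm
          · exact hv₂ h.symm
        rw [Function.update_of_ne h0]
        exact hz e ⟨he, h1, hne⟩
    rw [RBLeaf.prob_update_zero_atom_leaf ends s t w u _ hz' hwu _ hu, zero_mul, zero_div]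
  · intro A hu
    have mX := mass_notMem ends s t w u p hends₀ hends₁ hends₂ hv₁ hv₂ h12 h01 h02 hz hwu hsu htu
      _ hX hu
    have mY := mass_notMem ends s t w u p hends₀ hends₁ hends₂ hv₁ hv₂ h12 h01 h02 hz hwu hsu htu
      _ hY hu
    have mZ := mass_notMem ends s t w u p hends₀ hends₁ hends₂ hv₁ hv₂ h12 h01 h02 hz hwu hsu htu
      _ hU hu
    have mX' := mass_insert ends s t w u p hends₀ hends₁ hends₂ hv₁ hv₂ h12 h01 h02 hz hwu hsu htu
      _ hX hu
    have mY' := mass_insert ends s t w u p hends₀ hends₁ hends₂ hv₁ hv₂ h12 h01 h02 hz hwu hsu htu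
      _ hY hu
    have mZ' := mass_insert ends s t w u p hends₀ hends₁ hends₂ hv₁ hv₂ h12 h01 h02 hz hwu hsu htu
      _ hU hu
    simp only [Set.inter_univ] at mZ mZ'
    rw [mX, mY, mZ, mX', mY', mZ', hstar, hstar, hstar]
    -- the data of the pair identity
    have hz1 : prob (Function.update (Function.update (Function.update p f₁ 0) f₂ 0) e₀ 1)
        ((connEvent ends s t)ᶜ ∩ clusterEvent ends w A) = 0 →
        prob (Function.update (Function.update (Function.update p f₁ 0) f₂ 0) e₀ 1)
          ((connEvent ends s t)ᶜ ∩ clusterEvent ends w A ∩ connEvent ends x y) = 0 ∧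
        prob (Function.update (Function.update (Function.update p f₁ 0) f₂ 0) e₀ 1)
          ((connEvent ends s t)ᶜ ∩ clusterEvent ends w A ∩ connEvent ends x' y') = 0 := by
      intro h
      exact ⟨le_antisymm ((prob_mono hp1 Set.inter_subset_left).trans h.le) (prob_nonneg hp1 _),
        le_antisymm ((prob_mono hp1 Set.inter_subset_left).trans h.le) (prob_nonneg hp1 _)⟩
    have hz0 : prob (Function.update (Function.update (Function.update p f₁ 0) f₂ 0) e₀ 0)
        ((connEvent ends s t)ᶜ ∩ clusterEvent ends w A) = 0 →
        prob (Function.update (Function.update (Function.update p f₁ 0) f₂ 0) e₀ 0)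
          ((connEvent ends s t)ᶜ ∩ clusterEvent ends w A ∩ connEvent ends x y) = 0 ∧
        prob (Function.update (Function.update (Function.update p f₁ 0) f₂ 0) e₀ 0)
          ((connEvent ends s t)ᶜ ∩ clusterEvent ends w A ∩ connEvent ends x' y') = 0 := by
      intro h
      exact ⟨le_antisymm ((prob_mono hp0 Set.inter_subset_left).trans h.le) (prob_nonneg hp0 _),
        le_antisymm ((prob_mono hp0 Set.inter_subset_left).trans h.le) (prob_nonneg hp0 _)⟩
    have hmark : v₁ ∈ A ∧ v₂ ∈ A →
        prob (Function.update (Function.update (Function.update p f₁ 0) f₂ 0) e₀ 1)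
            ((connEvent ends s t)ᶜ ∩ clusterEvent ends w A ∩ connEvent ends x y) *
          prob (Function.update (Function.update (Function.update p f₁ 0) f₂ 0) e₀ 0)
            ((connEvent ends s t)ᶜ ∩ clusterEvent ends w A) =
        prob (Function.update (Function.update (Function.update p f₁ 0) f₂ 0) e₀ 0)
            ((connEvent ends s t)ᶜ ∩ clusterEvent ends w A ∩ connEvent ends x y) *
          prob (Function.update (Function.update (Function.update p f₁ 0) f₂ 0) e₀ 1)
            ((connEvent ends s t)ᶜ ∩ clusterEvent ends w A) ∧
        prob (Function.update (Function.update (Function.update p f₁ 0) f₂ 0) e₀ 1)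
            ((connEvent ends s t)ᶜ ∩ clusterEvent ends w A ∩ connEvent ends x' y') *
          prob (Function.update (Function.update (Function.update p f₁ 0) f₂ 0) e₀ 0)
            ((connEvent ends s t)ᶜ ∩ clusterEvent ends w A) =
        prob (Function.update (Function.update (Function.update p f₁ 0) f₂ 0) e₀ 0)
            ((connEvent ends s t)ᶜ ∩ clusterEvent ends w A ∩ connEvent ends x' y') *
          prob (Function.update (Function.update (Function.update p f₁ 0) f₂ 0) e₀ 1)
            ((connEvent ends s t)ᶜ ∩ clusterEvent ends w A) := fun h =>
      ⟨prob_update_atom_mul ends w _ (mem_touches_of_ends hends₀ (Or.inl h.1)) s t x y,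
        prob_update_atom_mul ends w _ (mem_touches_of_ends hends₀ (Or.inl h.1)) s t x' y'⟩
    have hbd : (v₁ ∈ A ∧ ¬ v₂ ∈ A) ∨ (¬ v₁ ∈ A ∧ v₂ ∈ A) →
        prob (Function.update (Function.update (Function.update p f₁ 0) f₂ 0) e₀ 1)
            ((connEvent ends s t)ᶜ ∩ clusterEvent ends w A ∩ connEvent ends x y) = 0 ∧
        prob (Function.update (Function.update (Function.update p f₁ 0) f₂ 0) e₀ 1)
            ((connEvent ends s t)ᶜ ∩ clusterEvent ends w A ∩ connEvent ends x' y') = 0 ∧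
        prob (Function.update (Function.update (Function.update p f₁ 0) f₂ 0) e₀ 1)
            ((connEvent ends s t)ᶜ ∩ clusterEvent ends w A) = 0 := by
      intro h
      have hb : ∀ (T : Set (Config E)), prob (Function.update (Function.update (Function.update p f₁ 0)
          f₂ 0) e₀ 1) ((connEvent ends s t)ᶜ ∩ clusterEvent ends w A ∩ T) = 0 := by
        intro T
        rcases h with ⟨h1, h2⟩ | ⟨h1, h2⟩
        · exact prob_update_one_atom_boundary ends s t w _ hends₀ T h1 h2
        · exact prob_update_one_atom_boundary ends s t w _ (by rw [hends₀, Sym2.eq_swap]) T h2 h1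
      refine ⟨hb _, hb _, ?_⟩
      have := hb Set.univ
      rwa [Set.inter_univ] at this
    have hz1n := prob_nonneg hp1 ((connEvent ends s t)ᶜ ∩ clusterEvent ends w A)
    have hz0n := prob_nonneg hp0 ((connEvent ends s t)ᶜ ∩ clusterEvent ends w A)
    generalize prob (Function.update (Function.update (Function.update p f₁ 0) f₂ 0) e₀ 1)
      ((connEvent ends s t)ᶜ ∩ clusterEvent ends w A ∩ connEvent ends x y) = x₁ at hz1 hmark hbd ⊢
    generalize prob (Function.update (Function.update (Function.update p f₁ 0) f₂ 0) e₀ 0)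
      ((connEvent ends s t)ᶜ ∩ clusterEvent ends w A ∩ connEvent ends x y) = x₀ at hz0 hmark ⊢
    generalize prob (Function.update (Function.update (Function.update p f₁ 0) f₂ 0) e₀ 1)
      ((connEvent ends s t)ᶜ ∩ clusterEvent ends w A ∩ connEvent ends x' y') = y₁ at hz1 hmark hbd ⊢
    generalize prob (Function.update (Function.update (Function.update p f₁ 0) f₂ 0) e₀ 0)
      ((connEvent ends s t)ᶜ ∩ clusterEvent ends w A ∩ connEvent ends x' y') = y₀ at hz0 hmark ⊢
    generalize prob (Function.update (Function.update (Function.update p f₁ 0) f₂ 0) e₀ 1)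
      ((connEvent ends s t)ᶜ ∩ clusterEvent ends w A) = z₁ at hz1 hmark hbd hz1n ⊢
    generalize prob (Function.update (Function.update (Function.update p f₁ 0) f₂ 0) e₀ 0)
      ((connEvent ends s t)ᶜ ∩ clusterEvent ends w A) = z₀ at hz0 hmark hz0n ⊢
    have key := pair_term (R := R) (hp.nonneg f₁) (hp.le_one f₁) (hp.nonneg f₂) (hp.le_one f₂)
      (hp.nonneg e₀) (hp.le_one e₀) hz1n hz0n hz1 hz0 (v₁ ∈ A) (v₂ ∈ A) hmark hbd
    dsimp only at key
    by_cases h₁ : v₁ ∈ A <;> by_cases h₂ : v₂ ∈ A <;>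
      simp only [h₁, h₂, or_true, true_or, or_self, not_true_eq_false, not_false_eq_true, if_true,
        if_false, mul_zero, add_zero, zero_add] at key ⊢ <;> exact key


omit [Fintype V] [LinearOrder R] [IsStrictOrderedRing R] in
/-- **The masses are preserved by the series reduction**: `P_p(Q ∩ {x ↔ y}) = P_{p*}(Q ∩ {x ↔ y})`
and `P_p(Q) = P_{p*}(Q)` for `x, y ≠ u`. -/
theorem prob_series_conn (p : E → R) {e₀ f₁ f₂ : E} {v₁ v₂ : V}
    (hends₀ : ends e₀ = s(v₁, v₂)) (hends₁ : ends f₁ = s(u, v₁)) (hends₂ : ends f₂ = s(u, v₂))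
    (hv₁ : v₁ ≠ u) (hv₂ : v₂ ≠ u) (h12 : f₁ ≠ f₂) (h01 : e₀ ≠ f₁) (h02 : e₀ ≠ f₂)
    (hz : ∀ e, u ∈ ends e ∧ e ≠ f₁ ∧ e ≠ f₂ → p e = 0) (hsu : s ≠ u) (htu : t ≠ u) {x y : V}
    (hx : x ≠ u) (hy : y ≠ u) :
    prob p ((connEvent ends s t)ᶜ ∩ connEvent ends x y) =
        prob (Function.update (Function.update (Function.update p e₀
          (p e₀ + (1 - p e₀) * (p f₁ * p f₂))) f₁ 0) f₂ 0) ((connEvent ends s t)ᶜ ∩ connEvent ends x y) ∧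
      prob p (connEvent ends s t)ᶜ =
        prob (Function.update (Function.update (Function.update p e₀
          (p e₀ + (1 - p e₀) * (p f₁ * p f₂))) f₁ 0) f₂ 0) (connEvent ends s t)ᶜ := by
  have hz' : ∀ e, u ∈ ends e ∧ e ≠ f₁ ∧ e ≠ f₂ → Function.update (Function.update (Function.update p e₀
      (p e₀ + (1 - p e₀) * (p f₁ * p f₂))) f₁ 0) f₂ 0 e = 0 := by
    rintro e ⟨he, h1, h2⟩
    have h0 : e ≠ e₀ := by
      rintro rfl
      rw [hends₀] at he
      rcases Sym2.mem_iff.1 he with h | h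
      · exact hv₁ h.symm
      · exact hv₂ h.symm
    rw [Function.update_of_ne h2, Function.update_of_ne h1, Function.update_of_ne h0]
    exact hz e ⟨he, h1, h2⟩
  -- the closed-at-`u` event is invariant under `eff`
  have hC : ∀ ω : Config E, (∀ e, u ∈ ends e ∧ e ≠ f₁ ∧ e ≠ f₂ → ω e = false) ↔
      (∀ e, u ∈ ends e ∧ e ≠ f₁ ∧ e ≠ f₂ → eff e₀ f₁ f₂ ω e = false) := by
    intro ω
    refine forall_congr' fun e => imp_congr_right fun he => ?_
    have h0 : e ≠ e₀ := by
      rintro rfl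
      rw [hends₀] at he
      rcases Sym2.mem_iff.1 he.1 with h | h
      · exact hv₁ h.symm
      · exact hv₂ h.symm
    unfold eff
    rw [Function.update_of_ne he.2.2, Function.update_of_ne he.2.1, Function.update_of_ne h0]
  -- a connection event among vertices `≠ u`, on the closed-at-`u` event, is `eff`-invariant
  have key : ∀ (S : Set (Config E)), (∀ ω : Config E, (∀ e, u ∈ ends e ∧ e ≠ f₁ ∧ e ≠ f₂ → ω e = false) →
      (ω ∈ S ↔ eff e₀ f₁ f₂ ω ∈ S)) →
      prob p S = prob (Function.update (Function.update (Function.update p e₀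
        (p e₀ + (1 - p e₀) * (p f₁ * p f₂))) f₁ 0) f₂ 0) S := by
    intro S hS
    rw [RBTwoMarkers.prob_inter_closed_of_zero p _ hz S, RBTwoMarkers.prob_inter_closed_of_zero _ _ hz' S]
    refine prob_series_transfer p h12 h01 h02 _ fun ω => ?_
    simp only [Set.mem_inter_iff, Set.mem_setOf_eq]
    constructor
    · rintro ⟨h1, h2⟩; exact ⟨(hS ω h2).1 h1, (hC ω).1 h2⟩
    · rintro ⟨h1, h2⟩
      have h2' := (hC ω).2 h2
      exact ⟨(hS ω h2').2 h1, h2'⟩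
  constructor
  · refine key _ fun ω hcl => ?_
    simp only [Set.mem_inter_iff, Set.mem_compl_iff, mem_connEvent]
    rw [conn_series ends u hends₀ hends₁ hends₂ hv₂ h12 h01 h02 hcl hsu htu,
      conn_series ends u hends₀ hends₁ hends₂ hv₂ h12 h01 h02 hcl hx hy]
  · refine key _ fun ω hcl => ?_
    simp only [Set.mem_compl_iff, mem_connEvent]
    rw [conn_series ends u hends₀ hends₁ hends₂ hv₂ h12 h01 h02 hcl hsu htu]

end Sum

section Typed

variable {V : Type*} {E : Type*} [Fintype E] [DecidableEq E] [Fintype V] {R : Type*} [Field R]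
  [LinearOrder R] [IsStrictOrderedRing R]

/-- **One series step preserves both forms of the typed row exactly**: for `u ∉ {s, t, b, o, w}`
with exactly the edges `f₁ = {u, v₁}`, `f₂ = {u, v₂}` of nonzero weight and an edge `e₀ = {v₁, v₂}`,
`RBcross ∧ RBsame` at `p` iff at `p* = p[e₀ ↦ p e₀ + (1 − p e₀) p f₁ p f₂][f₁ ↦ 0][f₂ ↦ 0]`. -/
theorem RBcross_and_RBsame_series_iff {p : E → R} (hp : IsProbVec p) (ends : E → Sym2 V)
    (o b s t w u : V) {e₀ f₁ f₂ : E} {v₁ v₂ : V} (hends₀ : ends e₀ = s(v₁, v₂))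
    (hends₁ : ends f₁ = s(u, v₁)) (hends₂ : ends f₂ = s(u, v₂)) (hv₁ : v₁ ≠ u) (hv₂ : v₂ ≠ u)
    (h12 : f₁ ≠ f₂) (h01 : e₀ ≠ f₁) (h02 : e₀ ≠ f₂)
    (huniq : ∀ e, u ∈ ends e → p e ≠ 0 → e = f₁ ∨ e = f₂) (hus : u ≠ s) (hut : u ≠ t) (hub : u ≠ b)
    (huo : u ≠ o) (huw : u ≠ w) :
    (RB.RBcross p ends o b s t w ∧ RB.RBsame p ends o b s t w) ↔
      (RB.RBcross (Function.update (Function.update (Function.update p e₀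
          (p e₀ + (1 - p e₀) * (p f₁ * p f₂))) f₁ 0) f₂ 0) ends o b s t w ∧
        RB.RBsame (Function.update (Function.update (Function.update p e₀
          (p e₀ + (1 - p e₀) * (p f₁ * p f₂))) f₁ 0) f₂ 0) ends o b s t w) := by
  have hz : ∀ e, u ∈ ends e ∧ e ≠ f₁ ∧ e ≠ f₂ → p e = 0 := by
    rintro e ⟨he, h1, h2⟩
    by_contra h
    rcases huniq e he h with rfl | rfl
    · exact h1 rfl
    · exact h2 rfl
  obtain ⟨m1, m2⟩ := prob_series_conn ends s t u p hends₀ hends₁ hends₂ hv₁ hv₂ h12 h01 h02 hz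
    hus.symm hut.symm hub.symm hus.symm
  obtain ⟨m3, -⟩ := prob_series_conn ends s t u p hends₀ hends₁ hends₂ hv₁ hv₂ h12 h01 h02 hz
    hus.symm hut.symm huo.symm hut.symm
  obtain ⟨m4, -⟩ := prob_series_conn ends s t u p hends₀ hends₁ hends₂ hv₁ hv₂ h12 h01 h02 hz
    hus.symm hut.symm huo.symm hus.symm
  unfold RB.RBcross RB.RBsame RB.Qst
  rw [RB.rbSum_eq_rbRoot, RB.rbSum_eq_rbRoot, RB.rbSum_eq_rbRoot, RB.rbSum_eq_rbRoot,
    rbSum_series ends s t w u p hp hends₀ hends₁ hends₂ hv₁ hv₂ h12 h01 h02 hz huw.symm hus.symm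
      hut.symm hub.symm hus.symm huo.symm hut.symm,
    rbSum_series ends s t w u p hp hends₀ hends₁ hends₂ hv₁ hv₂ h12 h01 h02 hz huw.symm hus.symm
      hut.symm hub.symm hus.symm huo.symm hus.symm, m1, m2, m3, m4]

end Typed

end RBSeries

end Summit.Ventures.PercRepro2
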